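import Summits.NavierStokesRegularity.NavierStokesRegularity.Theorems.RecurrentProfilesRecurrentReductionOrbit
import Summits.NavierStokesRegularity.NavierStokesRegularity.Theorems.RecurrentProfilesRecurrentLiouvillePrProximalTools
import Summits.NavierStokesRegularity.NavierStokesRegularity.Theorems.SqueezeCycleRecurrentLiouvilleNearIdentityDSS
import Literature.Analysis.FluidPDE.ScalingRecurrentSlabField
import HarnessLib

/-!
# Crux `RecurrentLiouville` (stmt-NavierStokesRegularity-1589), line `Sketch` v9 — stub H3:
# the PROXIMAL RECURRENT REDUCTION in the Albritton–Barker class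

`stub_prProximalReduction` (lead c11): if a suitable weak solution `(u, p)` of Navier–Stokes
(`ν = 1`, `f = 0`) on the backward slab `ℝ₋ × ℝ³` with weak gradient `G`, Albritton–Barker
quantity `𝐈 < ∞` and the Type-I rate `‖u(t,x)‖ ≤ C/√(−t)` is singular at the origin, then there are
a profile `w` of the same class (same `C`), singular at the origin and UNIFORMLY RECURRENT under the
scaling `σ ↦ w_{e^σ}` in `L³_loc({t ≤ 0} × ℝ³)`, and BLOW-UP SCALES `λₙ → 0⁺` along which `u` and
`w` become indistinguishable: `‖u_{λₙ} − w_{λₙ}‖_{L³(K)} → 0` for every compact `K ⊆ {t ≤ 0} × ℝ³`.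
Every Type-I singularity is thus asymptotically recurrent along a sequence of blow-up scales — a
strengthening of the route item `RecurrentReduction` (stmt-NavierStokesRegularity-1590,
`recurrentReduction_proof`), whose Birkhoff point need not be shadowed by `u`.

Proof.  MODEL (the model of `recurrentReduction_proof`): the `L³_loc` slab-field space
`Literature.Analysis.FluidPDE.SlabField ℝ³ ℝ³ 3` (fields lying in every `L³(Q(0, R))`, Fréchet
topology of the seminorms `L³(Q(0, n+1))`, pseudo-metrisable) with its scaling flow
`SlabField.flow σ w = w_{e^σ}` (continuous maps, action law, `flow 0 = id`); `S` = the orbit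
closure of `u`, compact (`SlabField.isCompact_closure_orbit`) by the tree's engine
`exists_orbit_limit` (Albritton–Barker compactness + persistence of singularities).  ABSTRACT DYNAMICS (`stub_prProximalTools`, file `…PrProximalTools.lean`: separation
quotient of `S`, Auslander–Ellis `stub_prAuslanderEllis` for the BACKWARD unit-step action,
two-sidedness `stub_prTwoSidedRecurrence`, lift along the inducing quotient map): a uniformly
recurrent point `y ∈ S` of the flow such that either `u` and `y` are topologically
indistinguishable (a.e. equal on the slab, `SlabField.inseparable_iff`), or `ϕ(−mₖ) u → z` and
`ϕ(−mₖ) y → z` for some steps `mₖ → ∞` and `z ∈ S`.  DICTIONARY: the field of `y` is uniformly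
recurrent under scaling (`SlabField.isUniformlyRecurrentPt_iff`).  IDENTIFICATION (as in item 1590):
`y` is an `L³_loc` limit of orbit points, hence a.e. equal (`SlabField.ae_eq_of_tendsto`) to an
engine limit — a suitable weak solution with
`𝐈 < ∞`, singular origin, rate a.e. — and to its pointwise-rate representative `w`
(`exists_rate_profile_repr`).  SCALES: in the second alternative `λₖ = e^{−mₖ} → 0`, and convergence
to the common point `z` in every `L³(Q(0, n+1))` gives `‖u_{λₖ} − w_{λₖ}‖_{L³(K)} → 0`
(`L³(K) ≤ L³(Q(0, n+1))`, null sets of the slab are invisible); in the first, `u = w` a.e. on the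
slab and any `λₖ → 0` works.

## References

* J. Auslander, Proc. AMS 11 (1960) 890–895; R. Ellis, Trans. AMS 94 (1960) 272–281;
  H. Furstenberg, *Recurrence in Ergodic Theory and Combinatorial Number Theory* (1981), Ch. 8,
  Thm. 8.7. [Furstenberg1981]
* D. Albritton, T. Barker, J. Math. Fluid Mech. 21 (2019), no. 43 = arXiv:1811.00502, Lemma 2.2,
  Prop. 2.3, §3. [AlbrittonBarker2019]
* G. Koch, N. Nadirashvili, G. Seregin, V. Šverák, Acta Math. 203 (2009), (1.4). [KNSS2009]
-/

noncomputable section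

-- the sub-problem namespace repeats the summit name (D-0017 layout `Summit.<S>.<P>.Theorems`)
set_option linter.dupNamespace false

namespace Summit.NavierStokesRegularity.NavierStokesRegularity.Theorems

open MeasureTheory Set Function Filter Topology TopologicalSpace Metric
open Literature.Analysis.FluidPDE
open Literature.Dynamics.TopologicalDynamics
open scoped NNReal ENNReal

/-! ### The proximal recurrent reduction -/

/-- **H3 · PROXIMAL RECURRENT REDUCTION** (registered stub of line `Sketch`, skeleton v9;
strengthening of item 1590 `RecurrentReduction`).  If a suitable weak solution `(u, p)` of
Navier–Stokes (`ν = 1`) on `ℝ³ × ℝ₋` with weak gradient `G`, `𝐈 < ⊤` and the rate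
`‖u(t,x)‖ ≤ C/√(−t)` is singular at the origin, then there are a profile `w` of the same class
(same `C`), singular at the origin and UNIFORMLY RECURRENT under scaling, and BLOW-UP scales
`λₙ → 0⁺` along which `u` and `w` become indistinguishable: `‖u_{λₙ} − w_{λₙ}‖_{L³(K)} → 0` for
every compact `K ⊆ {t ≤ 0} × ℝ³`.  Proof: the `L³_loc` slab-field model `SlabField ℝ³ ℝ³ 3` of
item 1590 (compact orbit closure, `SlabField.isCompact_closure_orbit`), separation quotient,
Auslander–Ellis for the backward unit-step action (`stub_prAuslanderEllis`), two-sidedness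
(`stub_prTwoSidedRecurrence`), the dictionary `SlabField.isUniformlyRecurrentPt_iff`,
identification with an engine limit and its rate representative (`SlabField.ae_eq_of_tendsto`,
`SlabField.inseparable_iff`), and extraction of the scales from a proximal sequence of backward
steps (see the module docstring).
[cite: Furstenberg1981, Ch. 8, Thm. 8.7; AlbrittonBarker2019, Lemma 2.2, Prop. 2.3] -/
theorem stub_prProximalReduction :
    ∀ (u : ℝ → EuclideanSpace ℝ (Fin 3) → EuclideanSpace ℝ (Fin 3))
      (p : ℝ → EuclideanSpace ℝ (Fin 3) → ℝ)
      (G : ℝ → EuclideanSpace ℝ (Fin 3) → EuclideanSpace ℝ (Fin 3) →L[ℝ] EuclideanSpace ℝ (Fin 3))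
      (C : ℝ),
      IsSuitableWeakSolutionOn (slab (EuclideanSpace ℝ (Fin 3)) (Iio 0) isOpen_Iio) 1 0 u p →
      HasWeakSpatialGradientOn (slab (EuclideanSpace ℝ (Fin 3)) (Iio 0) isOpen_Iio) u G →
      typeIBound (Iio (0 : ℝ) ×ˢ univ) u p G < ⊤ →
      HasTypeITimeDecay C u →
      IsBackwardSingularPoint u 0 →
      ∃ (w : ℝ → EuclideanSpace ℝ (Fin 3) → EuclideanSpace ℝ (Fin 3))
        (q : ℝ → EuclideanSpace ℝ (Fin 3) → ℝ)
        (H : ℝ → EuclideanSpace ℝ (Fin 3) → EuclideanSpace ℝ (Fin 3) →L[ℝ] EuclideanSpace ℝ (Fin 3)),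
        IsSuitableWeakSolutionOn (slab (EuclideanSpace ℝ (Fin 3)) (Iio 0) isOpen_Iio) 1 0 w q ∧
        HasWeakSpatialGradientOn (slab (EuclideanSpace ℝ (Fin 3)) (Iio 0) isOpen_Iio) w H ∧
        typeIBound (Iio (0 : ℝ) ×ˢ univ) w q H < ⊤ ∧
        HasTypeITimeDecay C w ∧
        IsBackwardSingularPoint w 0 ∧
        IsScalingUniformlyRecurrent w ∧
        ∃ lam : ℕ → ℝ, (∀ n, 0 < lam n) ∧ Tendsto lam atTop (𝓝 0) ∧
          ∀ K : Set (ℝ × EuclideanSpace ℝ (Fin 3)), IsCompact K → K ⊆ Iic (0 : ℝ) ×ˢ univ →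
            Tendsto (fun n => eLpNorm (fun z : ℝ × EuclideanSpace ℝ (Fin 3) =>
              nsRescale (lam n) u z.1 z.2 - nsRescale (lam n) w z.1 z.2) 3 (volume.restrict K))
              atTop (𝓝 0) := by
  intro u p G C hsw hwg hI hdec hsing
  classical
  haveI h13 : Fact (1 ≤ (3 : ℝ≥0∞)) := ⟨by norm_num⟩
  -- `0 ≤ C`
  have hC0 : 0 ≤ C := by
    have h := hdec (-1) (by norm_num) 0
    have h1 : (0 : ℝ) ≤ C / Real.sqrt (-(-1 : ℝ)) := (norm_nonneg _).trans h
    rw [neg_neg, Real.sqrt_one, div_one] at h1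
    exact h1
  -- ## the model: `u` as a point of the `L³_loc` slab-field space `SlabField ℝ³ ℝ³ 3`
  let x₀ : SlabField (EuclideanSpace ℝ (Fin 3)) (EuclideanSpace ℝ (Fin 3)) 3 :=
    SlabField.ofMemLp u fun R hR => memLp_three_of_slabProfile hwg hI hR
  -- ## KEY: subsequential limits of orbit sequences (the engine)
  have hkey : ∀ σs : ℕ → ℝ,
      ∃ (a : SlabField (EuclideanSpace ℝ (Fin 3)) (EuclideanSpace ℝ (Fin 3)) 3) (ψ : ℕ → ℕ),
      StrictMono ψ ∧ Tendsto (fun j => SlabField.flow (σs (ψ j)) x₀) atTop (𝓝 a) ∧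
      ∃ (q : ℝ → EuclideanSpace ℝ (Fin 3) → ℝ)
        (H : ℝ → EuclideanSpace ℝ (Fin 3) → EuclideanSpace ℝ (Fin 3) →L[ℝ] EuclideanSpace ℝ (Fin 3)),
        IsSuitableWeakSolutionOn (slab (EuclideanSpace ℝ (Fin 3)) (Iio 0) isOpen_Iio) 1 0 a.toFun q ∧
        HasWeakSpatialGradientOn (slab (EuclideanSpace ℝ (Fin 3)) (Iio 0) isOpen_Iio) a.toFun H ∧
        typeIBound (Iio (0 : ℝ) ×ˢ univ) a.toFun q H < ⊤ ∧ IsBackwardSingularPoint a.toFun 0 ∧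
        (∀ᵐ z ∂(volume.restrict (Iio (0 : ℝ) ×ˢ (univ : Set (EuclideanSpace ℝ (Fin 3))))),
          ‖a.toFun z.1 z.2‖ ≤ C / Real.sqrt (-z.1)) := by
    intro σs
    obtain ⟨u', p', H', ψ, hψ, hsw', hwg', hI', hsing', hrate', hconv'⟩ :=
      exists_orbit_limit hsw hwg hI hsing hdec (fun k => Real.exp (σs k)) (fun k => Real.exp_pos _)
    have hI'' : typeIBound (Iio (0 : ℝ) ×ˢ univ) u' p' H' < ⊤ :=
      lt_of_le_of_lt hI' (ENNReal.mul_lt_top (by simp) hI)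
    refine ⟨SlabField.ofMemLp u' fun R hR => memLp_three_of_slabProfile hwg' hI'' hR, ψ, hψ, ?_,
      p', H', hsw', hwg', hI'', hsing', hrate'⟩
    rw [SlabField.tendsto_flow_iff_forall]
    exact hconv'
  -- ## the orbit closure: invariant and compact (Albritton–Barker compactness fed to the model)
  set S : Set (SlabField (EuclideanSpace ℝ (Fin 3)) (EuclideanSpace ℝ (Fin 3)) 3) :=
    closure (range fun σ => SlabField.flow σ x₀) with hS
  have hScpt : IsCompact S :=
    x₀.isCompact_closure_orbit fun σs => by
      obtain ⟨a, ψ, hψ, ha, -⟩ := hkey σs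
      exact ⟨a, ψ, hψ, ha⟩
  -- ## the abstract dynamics: a uniformly recurrent point of `S` reached along backward steps
  obtain ⟨y, hyS, hrecy, hprox⟩ :=
    stub_prProximalTools SlabField.continuous_flow SlabField.flow_add SlabField.flow_zero hScpt
      (SlabField.mapsTo_flow_closure_orbit (w := x₀)) x₀.mem_closure_orbit_self
  -- ## the dictionary: the field of `y` is uniformly recurrent under scaling
  have hrecF : IsScalingUniformlyRecurrent y.toFun := (SlabField.isUniformlyRecurrentPt_iff y).1 hrecy
  -- ## identification of `y` with an engine limit, up to a null set of the slab
  obtain ⟨xs, hxs, hxa⟩ := mem_closure_iff_seq_limit.1 hyS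
  choose τs hτs using hxs
  obtain ⟨b, ψ, hψ, hb, q, H, hswb, hwgb, hIb, hsingb, hrateb⟩ := hkey τs
  have hxa' : Tendsto (fun j => SlabField.flow (τs (ψ j)) x₀) atTop (𝓝 y) :=
    (hxa.comp hψ.tendsto_atTop).congr fun j => (hτs (ψ j)).symm
  have hab := SlabField.ae_eq_of_tendsto hb hxa'
  -- ## the pointwise rate: modification on a null set of the slab
  obtain ⟨w, hbw, hsww, hwgw, hIw, hdecw, hsingw⟩ :=
    exists_rate_profile_repr hC0 hswb hwgb hIb hsingb hrateb
  have hyw : ∀ᵐ z ∂(volume.restrict (Iio (0 : ℝ) ×ˢ (univ : Set (EuclideanSpace ℝ (Fin 3))))),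
      y.toFun z.1 z.2 = w z.1 z.2 := by
    filter_upwards [hab, hbw] with z hz hz'
    exact hz.symm.trans hz'
  have hrecw : IsScalingUniformlyRecurrent w := hrecF.congr_ae hyw
  -- ## rescaled differences do not see the null set: `‖u_c − w_c‖_{L³(K)} = ‖u_c − y_c‖_{L³(K)}`
  have hKcongr : ∀ {c : ℝ}, 0 < c → ∀ K : Set (ℝ × EuclideanSpace ℝ (Fin 3)),
      K ⊆ Iic (0 : ℝ) ×ˢ univ →
      eLpNorm (fun z : ℝ × EuclideanSpace ℝ (Fin 3) => nsRescale c u z.1 z.2 - nsRescale c w z.1 z.2) 3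
          (volume.restrict K) =
        eLpNorm (fun z : ℝ × EuclideanSpace ℝ (Fin 3) =>
          nsRescale c u z.1 z.2 - nsRescale c y.toFun z.1 z.2) 3 (volume.restrict K) := by
    intro c hc K hKH
    have ht := rlNearIdentityDSS_ae_comp_dilation (F := fun z => y.toFun z.1 z.2)
      (G := fun z => w z.1 z.2) hc hyw
    refine eLpNorm_congr_ae ?_
    filter_upwards [ae_restrict_of_ae_restrict_Iio_prod_univ ht hKH] with z hz
    simp only [nsRescale_apply]
    rw [hz]
  -- ## the scales, from the proximality alternative
  rcases hprox with hins | ⟨m, zX, -, hm, h1, h2⟩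
  · -- ### indistinguishable classes: `u = w` a.e. and any blow-up scales work
    have huw : ∀ᵐ z ∂(volume.restrict (Iio (0 : ℝ) ×ˢ (univ : Set (EuclideanSpace ℝ (Fin 3))))),
        u z.1 z.2 = w z.1 z.2 := by
      filter_upwards [SlabField.inseparable_iff.1 hins, hyw] with z hz hz'
      exact hz.trans hz'
    refine ⟨w, q, H, hsww, hwgw, hIw, hdecw, hsingw, hrecw, fun k => Real.exp (-(k : ℝ)),
      fun k => Real.exp_pos _, ?_, ?_⟩
    · exact Real.tendsto_exp_atBot.comp (tendsto_neg_atTop_atBot.comp tendsto_natCast_atTop_atTop)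
    · intro K _ hKH
      have hzero : ∀ k : ℕ, eLpNorm (fun z : ℝ × EuclideanSpace ℝ (Fin 3) =>
          nsRescale (Real.exp (-(k : ℝ))) u z.1 z.2 - nsRescale (Real.exp (-(k : ℝ))) w z.1 z.2) 3
          (volume.restrict K) = 0 := by
        intro k
        have hc : 0 < Real.exp (-(k : ℝ)) := Real.exp_pos _
        have ht := rlNearIdentityDSS_ae_comp_dilation (F := fun z => u z.1 z.2)
          (G := fun z => w z.1 z.2) hc huw
        refine (eLpNorm_congr_ae ?_).trans eLpNorm_zero
        filter_upwards [ae_restrict_of_ae_restrict_Iio_prod_univ ht hKH] with z hz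
        simp only [nsRescale_apply, Pi.zero_apply]
        rw [hz, sub_self]
      simp only [hzero]
      exact tendsto_const_nhds
  · -- ### proximal steps `m k → ∞`: blow-up scales `λ_k = e^{-m_k} → 0` with a common limit `zX`
    rw [SlabField.tendsto_iff_forall_nat] at h1 h2
    refine ⟨w, q, H, hsww, hwgw, hIw, hdecw, hsingw, hrecw, fun k => Real.exp (-(m k : ℝ)),
      fun k => Real.exp_pos _, ?_, ?_⟩
    · exact Real.tendsto_exp_atBot.comp
        (tendsto_neg_atTop_atBot.comp (tendsto_natCast_atTop_atTop.comp hm))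
    · intro K hK hKH
      obtain ⟨n, hn⟩ := exists_eLpNorm_restrict_le_of_isCompact hK hKH
      -- triangle inequality in `L³(Q(0, n+1))` through the common limit `zX`
      have htri : ∀ k, eLpNorm (fun z : ℝ × EuclideanSpace ℝ (Fin 3) =>
          nsRescale (Real.exp (-(m k : ℝ))) u z.1 z.2 -
            nsRescale (Real.exp (-(m k : ℝ))) y.toFun z.1 z.2) 3 (volume.restrict K) ≤
          eLpNorm (uncurry (SlabField.flow (-(m k : ℝ)) x₀).toFun - uncurry zX.toFun) 3
              (volume.restrict (parabolicCylinder ((n : ℝ) + 1) (0 : ℝ × EuclideanSpace ℝ (Fin 3)))) +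
            eLpNorm (uncurry (SlabField.flow (-(m k : ℝ)) y).toFun - uncurry zX.toFun) 3
              (volume.restrict (parabolicCylinder ((n : ℝ) + 1) (0 : ℝ × EuclideanSpace ℝ (Fin 3)))) := by
        intro k
        refine (hn _ 3).trans ?_
        have e : (fun z : ℝ × EuclideanSpace ℝ (Fin 3) =>
            nsRescale (Real.exp (-(m k : ℝ))) u z.1 z.2 -
              nsRescale (Real.exp (-(m k : ℝ))) y.toFun z.1 z.2) =
            (uncurry (SlabField.flow (-(m k : ℝ)) x₀).toFun - uncurry zX.toFun) -
              (uncurry (SlabField.flow (-(m k : ℝ)) y).toFun - uncurry zX.toFun) := by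
          funext z
          simp only [Pi.sub_apply, uncurry, sub_sub_sub_cancel_right]
          rfl
        rw [e]
        exact eLpNorm_sub_le
          (((SlabField.flow (-(m k : ℝ)) x₀).memLp _).1.sub (zX.memLp _).1)
          (((SlabField.flow (-(m k : ℝ)) y).memLp _).1.sub (zX.memLp _).1) (by norm_num)
      have hsum : Tendsto (fun k =>
          eLpNorm (uncurry (SlabField.flow (-(m k : ℝ)) x₀).toFun - uncurry zX.toFun) 3
              (volume.restrict (parabolicCylinder ((n : ℝ) + 1) (0 : ℝ × EuclideanSpace ℝ (Fin 3)))) +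
            eLpNorm (uncurry (SlabField.flow (-(m k : ℝ)) y).toFun - uncurry zX.toFun) 3
              (volume.restrict (parabolicCylinder ((n : ℝ) + 1) (0 : ℝ × EuclideanSpace ℝ (Fin 3)))))
          atTop (𝓝 0) := by
        have h := (h1 n).add (h2 n)
        rwa [add_zero] at h
      have hmain : Tendsto (fun k => eLpNorm (fun z : ℝ × EuclideanSpace ℝ (Fin 3) =>
          nsRescale (Real.exp (-(m k : ℝ))) u z.1 z.2 -
            nsRescale (Real.exp (-(m k : ℝ))) y.toFun z.1 z.2) 3 (volume.restrict K)) atTop (𝓝 0) :=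
        tendsto_of_tendsto_of_tendsto_of_le_of_le tendsto_const_nhds hsum (fun _ => zero_le) htri
      refine hmain.congr fun k => ?_
      exact (hKcongr (Real.exp_pos _) K hKH).symm

end Summit.NavierStokesRegularity.NavierStokesRegularity.Theorems

end
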